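import Summits.CriticalPhenomena.CardyFormulaZ2.Theorems.CardyIKTransportIKMixedBoxCrossingDefectColourLawMixture
import Summits.CriticalPhenomena.CardyFormulaZ2.Theorems.CardyIKTransportIKMixedBoxCrossingQuenchedDefs

/-!
# Line `defect-closure-exploration` v7 / ALT line `quenched-chain-fkg` — VOCABULARY of the EXACT QUENCHED MIXTURE (Q) behind
# `ApproxHarrisFam` (crux `IKMixedBoxCrossing`, stmt-CriticalPhenomena-5911; lead c7, programme of strategist s2's card §1/§3)

Definitions-only support file (`--supports stmt-CriticalPhenomena-5911`).  Nothing is asserted: every `def … : Prop` is a statement the LINE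
POSITS (a registered stub), never a literature fact.  Everything is FINITE: black sets `s ⊆ Λ` of a finite cell box `Λ : Finset (Site 2)`.

THE OBJECTS.  The free mixed colour law on `Λ` is (landed `stub_colourLawMixture`, c3 L1) the average over an i.i.d. Bernoulli(ρ) DEFECT set
`D ⊆ facesIn S Λ` of the uniform measure on the `D`-even black sets (`cornerGibbsMeasure 0 D Λ white`).  Two defect faces are LINKED when
their 2 × 2 blocks `cellFace` meet; the blocks of a linked component `K` (recorded below by its CELL SET, the components' cell sets being pairwise
disjoint) carry the LOCAL CODE `localCode D K` = black subsets of `K` making every face of `D` inside `K` even; the cells of `Λ` in no block are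
FREE.  A `D`-even black set is exactly: an arbitrary subset of the free cells together with one local codeword per component (`code_iff`, stub).
An ENVIRONMENT is `ξ = (D, v)` with one PATTERN `v K ∈ localCode D K ∖ {∅, K}` per component; the QUENCHED WEIGHT of a black set `s ⊆ Λ` is
`2^{-|free|} ∏_K chainW K (v K) (s ∩ K)` with the three-point chain weights `chainW` (`∅ ↦ 1/|V_K|`, `v K ↦ (|V_K|−2)/|V_K|`, `K ↦ 1/|V_K|`, else 0),
and the environment weight is `ρ^|D| (1−ρ)^{|facesIn S Λ|−|D|} ∏_K (|V_K| − 2)⁻¹`.  STATEMENTS posited (stubs of the programme):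
* `QuenchedMixture` (M): summing the quenched weights against the environment weights gives back the free colour law (chain decomposition
  `chain_decomposition`, landed in `…QuenchedDefs.lean`, per component, plus the product structure of the code);
* `QuenchedLogSupermodular` (L): every quenched weight is log-supermodular on `Λ.powerset` (each `chainW` has totally ordered support);
* `QuenchedHarris` (H): hence Harris–FKG for the quenched weights — increasing families of black sets are positively correlated (Mathlib `fkg`);
* `AnnealedQuenchedBound` (A): consequently `colourLaw(∩ 𝒜_i) ≥ E_ξ ∏_i P_ξ(𝒜_i)` for increasing `𝒜_i` — Harris up to the environment
  variance, the inequality from which `ApproxHarrisFam` is to be proved by a concentration estimate (card §3).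
DISPROOF USED: `colourField_not_positivelyAssociated` is respected — association is posited ONLY for the quenched weights; averaging the six
patterns of one isolated defect face reproduces the refuter's `Cov = −ρ/16` (card §1 sanity line).
-/

noncomputable section

namespace Summit.CriticalPhenomena.CardyFormulaZ2.Cruxes.IKMixedBoxCrossing.QuenchedChainFKG

open scoped Classical BigOperators ENNReal NNReal
open Finset MeasureTheory
open Literature.Probability.LatticeModels
open Summit.CriticalPhenomena.CardyFormulaZ2.Cruxes.IKMixedBoxCrossing.DefectClosureExploration (facesIn colourLaw maskDensity tIK)

/-! ## §1 Linked defect faces, components (by cell set), local codes, free cells -/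

/-- Two faces are LINKED when their 2 × 2 cell blocks meet (share at least one cell). -/
def FaceLinked (g g' : Site 2) : Prop := (cellFace g ∩ cellFace g').Nonempty

/-- The defect graph on a finite face set `D`: linked distinct faces are adjacent. -/
def defectGraph (D : Finset (Site 2)) : SimpleGraph {g // g ∈ D} :=
  SimpleGraph.fromRel fun a b => FaceLinked a.1 b.1

/-- Adjacency in the defect graph is decidable (classically). -/
instance (D : Finset (Site 2)) : DecidableRel (defectGraph D).Adj := fun _ _ => Classical.dec _

/-- The CELL SET of the linked component of the defect face `g`: the union of the blocks of the faces reachable from `g`. -/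
def compCells (D : Finset (Site 2)) (g : {g // g ∈ D}) : Finset (Site 2) :=
  (D.attach.filter fun g' => (defectGraph D).Reachable g g').biUnion fun g' => cellFace g'.1

/-- The components of `D`, recorded by their (pairwise disjoint) cell sets. -/
def comps (D : Finset (Site 2)) : Finset (Finset (Site 2)) := D.attach.image (compCells D)

/-- The LOCAL CODE of a component cell set `K`: black subsets of `K` for which every defect face whose block lies in `K` is even. -/
def localCode (D : Finset (Site 2)) (K : Finset (Site 2)) : Finset (Finset (Site 2)) :=
  K.powerset.filter fun τ => ∀ g ∈ D, cellFace g ⊆ K → ¬ IsOddFace (fun x => decide (x ∈ τ)) g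

/-- The FREE cells of `Λ`: those in no block of `D`. -/
def freeCells (D Λ : Finset (Site 2)) : Finset (Site 2) := Λ.filter fun x => ∀ g ∈ D, x ∉ cellFace g

/-! ## §2 Environments and quenched weights -/

/-- Admissible PATTERNS for `D`: one local codeword per component, neither empty nor full. -/
def patterns (D : Finset (Site 2)) : Finset (Finset (Site 2) → Finset (Site 2)) :=
  ((comps D).pi fun K => ((localCode D K).erase ∅).erase K).image fun f K => if h : K ∈ comps D then f K h else ∅

/-- The three-point CHAIN WEIGHT of a component with cell set `K`, code size `V`, pattern `vK`, read at the local black set `τ`. -/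
def chainW (V : ℕ) (K vK τ : Finset (Site 2)) : ℝ :=
  if τ = ∅ then 1 / V else if τ = K then 1 / V else if τ = vK then ((V : ℝ) - 2) / V else 0

/-- The QUENCHED WEIGHT of the black set `s ⊆ Λ` in the environment `(D, v)` (zero off `Λ.powerset`). -/
def quenchedW (D Λ : Finset (Site 2)) (v : Finset (Site 2) → Finset (Site 2)) (s : Finset (Site 2)) : ℝ :=
  if s ⊆ Λ then ((1 : ℝ) / 2) ^ (freeCells D Λ).card * ∏ K ∈ comps D, chainW (localCode D K).card K (v K) (s ∩ K) else 0

/-- The ENVIRONMENT WEIGHT of `(D, v)` for the pattern `S` on `Λ` (`ρ = maskDensity tIK = 7 − 4√3`). -/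
def envW (S : Set ℤ) (Λ D : Finset (Site 2)) : ℝ :=
  maskDensity tIK ^ D.card * (1 - maskDensity tIK) ^ ((facesIn S Λ).card - D.card) *
    ∏ K ∈ comps D, 1 / (((localCode D K).card : ℝ) - 2)

/-- Quenched probability of a family `𝒜` of black sets. -/
def quenchedProb (D Λ : Finset (Site 2)) (v : Finset (Site 2) → Finset (Site 2)) (𝒜 : Finset (Finset (Site 2))) : ℝ :=
  ∑ s ∈ 𝒜, quenchedW D Λ v s

/-! ## §3 The statements the programme POSITS (stubs) -/

/-- (C) PRODUCT STRUCTURE OF THE CODE: for `D` inside `Λ` (`D ⊆ innerVertices Λ`), a subset `s ⊆ Λ` is `D`-even iff each of its component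
traces is a local codeword (the free part is arbitrary).  A statement to be proved (registered stub), not asserted here. -/
def CodeIff : Prop :=
  ∀ (D Λ : Finset (Site 2)), D ⊆ innerVertices Λ → ∀ s ⊆ Λ,
    ((∀ g ∈ D, ¬ IsOddFace (fun x => decide (x ∈ s)) g) ↔ ∀ K ∈ comps D, s ∩ K ∈ localCode D K)

/-- (M) THE EXACT QUENCHED MIXTURE: for every pattern `S`, box `Λ` and family `𝒜 ⊆ Λ.powerset` of black sets,
`colourLaw S Λ {boxFill Λ white s | s ∈ 𝒜} = ∑_D ∑_{v ∈ patterns D} envW · quenchedProb D Λ v 𝒜` — the free mixed colour law IS the average of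
the quenched laws over the colourless environment.  A statement to be proved (registered stub), not asserted here. -/
def QuenchedMixture : Prop :=
  ∀ (S : Set ℤ) (Λ : Finset (Site 2)) (𝒜 : Finset (Finset (Site 2))), 𝒜 ⊆ Λ.powerset →
    (colourLaw S Λ ((fun s => boxFill Λ (fun _ => false) s) '' ↑𝒜)).toReal =
      ∑ D ∈ (facesIn S Λ).powerset, ∑ v ∈ patterns D, envW S Λ D * quenchedProb D Λ v 𝒜

/-- (L) LOG-SUPERMODULARITY of every quenched weight on the black sets (each chain weight has totally ordered support
`∅ ⊂ v K ⊂ K`, products over the disjoint component cell sets and the free product measure preserve the lattice condition).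
A statement to be proved (registered stub), not asserted here. -/
def QuenchedLogSupermodular : Prop :=
  ∀ (D Λ : Finset (Site 2)), D ⊆ innerVertices Λ → ∀ v ∈ patterns D, ∀ a b : Finset (Site 2),
    quenchedW D Λ v a * quenchedW D Λ v b ≤ quenchedW D Λ v (a ∩ b) * quenchedW D Λ v (a ∪ b)

/-- (H) QUENCHED HARRIS–FKG: for finitely many INCREASING families `𝒜_i` (up-sets within `Λ.powerset`) the quenched probabilities are
positively correlated: `Z^{k−1} · P_ξ(∩ 𝒜_i) ≥ ∏_i P_ξ(𝒜_i)` with `Z = P_ξ(Λ.powerset)` (= 1, part of (M)); from (L) by Mathlib's `fkg` on the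
Boolean lattice `Λ.powerset` and induction on `k`.  A statement to be proved (registered stub), not asserted here. -/
def QuenchedHarris : Prop :=
  ∀ (D Λ : Finset (Site 2)), D ⊆ innerVertices Λ → ∀ v ∈ patterns D, ∀ (k : ℕ) (𝒜 : Fin k → Finset (Finset (Site 2))),
    (∀ i, 𝒜 i ⊆ Λ.powerset ∧ ∀ s ∈ 𝒜 i, ∀ t ⊆ Λ, s ⊆ t → t ∈ 𝒜 i) →
      (∏ i, quenchedProb D Λ v (𝒜 i)) ≤
        quenchedProb D Λ v Λ.powerset ^ (k - 1) * quenchedProb D Λ v (Λ.powerset.filter fun s => ∀ i, s ∈ 𝒜 i)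

/-- (A) THE ANNEALED CONSEQUENCE: for increasing families the free colour law of the intersection dominates the environment-average of the
PRODUCT of quenched probabilities — Harris up to the environment variance (from (M) + (H) + `P_ξ(Λ.powerset) = 1`).  This is the inequality
from which `ApproxHarrisFam` is to be derived by a concentration estimate for `v ↦ quenchedProb D Λ v (box event)` (card §3).
A statement to be proved (registered stub), not asserted here. -/
def AnnealedQuenchedBound : Prop :=
  ∀ (S : Set ℤ) (Λ : Finset (Site 2)) (k : ℕ) (𝒜 : Fin k → Finset (Finset (Site 2))),
    (∀ i, 𝒜 i ⊆ Λ.powerset ∧ ∀ s ∈ 𝒜 i, ∀ t ⊆ Λ, s ⊆ t → t ∈ 𝒜 i) →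
      ∑ D ∈ (facesIn S Λ).powerset, ∑ v ∈ patterns D, envW S Λ D * ∏ i, quenchedProb D Λ v (𝒜 i) ≤
        (colourLaw S Λ ((fun s => boxFill Λ (fun _ => false) s) '' ↑(Λ.powerset.filter fun s => ∀ i, s ∈ 𝒜 i))).toReal

/-! ## §4 Registered stubs (name-keyed aliases) and the composition of the programme's first layer -/

namespace Registered
/-- Alias keyed by the registered stub name. -/
abbrev stub_codeIff : Prop := CodeIff
/-- Alias keyed by the registered stub name. -/
abbrev stub_quenchedMixture : Prop := QuenchedMixture
/-- Alias keyed by the registered stub name. -/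
abbrev stub_quenchedLogSupermodular : Prop := QuenchedLogSupermodular
/-- Alias keyed by the registered stub name. -/
abbrev stub_quenchedHarris : Prop := QuenchedLogSupermodular → QuenchedHarris
/-- Alias keyed by the registered stub name. -/
abbrev stub_annealedQuenchedBound : Prop := QuenchedMixture → QuenchedHarris → AnnealedQuenchedBound
end Registered

/-- **The first layer of the `ApproxHarrisFam` programme from its registered stubs** (registered composition, sorry-free): the annealed
bound (A) follows from the mixture (M), log-supermodularity (L), the FKG step (H) and the assembly. -/
theorem annealedQuenchedBound_of_registered :
    Registered.stub_quenchedMixture → Registered.stub_quenchedLogSupermodular → Registered.stub_quenchedHarris →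
      Registered.stub_annealedQuenchedBound → AnnealedQuenchedBound :=
  fun hM hL hH hA => hA hM (hH hL)

/-! ## §5 Elementary sanity facts (sorry-free) -/

/-- The chain weight vanishes off the three-point chain. -/
theorem chainW_eq_zero {V : ℕ} {K vK τ : Finset (Site 2)} (h0 : τ ≠ ∅) (hK : τ ≠ K) (hv : τ ≠ vK) :
    chainW V K vK τ = 0 := by
  simp [chainW, h0, hK, hv]

/-- The chain weight is nonnegative when the code has at least two words. -/
theorem chainW_nonneg {V : ℕ} (hV : 2 ≤ V) (K vK τ : Finset (Site 2)) : 0 ≤ chainW V K vK τ := by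
  unfold chainW
  have hV' : (2 : ℝ) ≤ V := by exact_mod_cast hV
  split_ifs <;> positivity

/-- The quenched weight vanishes off `Λ.powerset`. -/
theorem quenchedW_eq_zero_of_not_subset {D Λ : Finset (Site 2)} (v : Finset (Site 2) → Finset (Site 2)) {s : Finset (Site 2)}
    (hs : ¬ s ⊆ Λ) : quenchedW D Λ v s = 0 := by
  simp [quenchedW, hs]

end Summit.CriticalPhenomena.CardyFormulaZ2.Cruxes.IKMixedBoxCrossing.QuenchedChainFKG

end
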